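import Mathlib

/-!
# Rung V3: chart algebra of the plain three-step tower for the Jordan block `J₃` at `p = 3`

(crux stmt-ResolutionOfSingularities-15640 `WildQuotients.WildQuotientResolution`, line `Sketch`,
sector `|G| = p`; rung V3 of `L/w45c/CHAIN.md` v4 §4 row stub-1 «V3-ALGEBRA», hand computation
`L/w45c/CRUX-PLAN.md` v4 §V3.1 (planner res-L1-w45c-plan-1; engine-confirmed tri-1 j262219);
[OURS · L1 W4.5c] — NOT a statement of any manuscript; replaces the role of no printed item.
Route-independent: `import Mathlib` only.)

The `J₃` datum on `k[x]`: `σ x_b = x_b + x_a`, `σ x_c = x_c + x_b`, identity on the other coordinates,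
`char k = 3`; `g = σᵐ` (`3 ∤ m`) acts by `g x_b = x_b + m x_a`, `g x_c = x_c + m x_b + (m choose 2) x_a`,
and its augmentation ideal on `k[x]` is the first centre `(x_a, x_b)` (`…JordanThreeCentre`).

* §1 (generic, any blow-up chart): `span_sub_eq_map_sup_span_of_chart` — in the abstract chart
  setting of `TerminalBlowup.span_sub_eq_span_of_chart` (`R →ψ A = R[u_l] → S` a localisation,
  `a ∘ ι = ι ∘ b`) but WITHOUT invariant generators: the augmentation ideal of the lifted action is
  `⟨a y - y : y ∈ S⟩ = ⟨b r - r⟩·S ⊔ ⟨a ū_l - ū_l : l⟩` — «augmentation upstairs = augmentation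
  downstairs + the moves of the chart generators»; the moves are supplied by
  `TerminalBlowup.stalkAction_chartGen_of_chart` (p472666) and its unit-twisted variant (5′).
  `span_pow_sub_le` / `span_pow_sub_eq`: `⟨gʲ y - y⟩ ≤ ⟨g y - y⟩`, with equality when `g` is a power
  of `gʲ` (all generators of a cyclic group of prime order have the same augmentation ideal).
* §2 (the five charts of §V3.1 as ideal identities in ANY commutative ring `S` — stalks or stable
  affine charts alike; inputs = exactly the relation (5′) outputs for the new chart generator; `m` =
  the multiplier of `g = σᵐ`):
  step 1, chart A (`x_b = x_a t`): `a t - t = m` is a unit ⇒ augmentation ideal `= ⊤`;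
  step 1, chart B (`x_a = x_b u`, chart generator `x_b` twisted by `e = 1 + m u`):
    `a u · (1 + m u) = u` ⇒ `(x_b u, x_b, a u - u) = (x_b, u²)` (needs `m`, `1 + m u` units; the
    latter is automatic in a local ring, `isUnit_one_add_mul_of_mul_eq`) — bad locus `C₁ = V(x_b, u)`;
  step 2, chart B1 (`u = x_b v`): `a v · (1 + m x_b v)² = v` ⇒ `(x_b, (x_b v)², a v - v) = (x_b)`
    PRINCIPAL;
  step 2, chart B2 (`x_b = u w`): `a w = w (1 + m u)²` ⇒ `(u w, u², a w - w) = (u², u w)` (`= (u)`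
    where `w` is a unit, `= ⊤` where `u` is a unit) — bad locus `C₂ = V(u, w)`;
  step 3, chart B2a (`w = u y`): `a y = y (1 + m u)³`, `3 = 0` ⇒ `(u², u·u y, a y - y) = (u²)`
    PRINCIPAL;
  step 3, chart B2b (`u = w z`): `a z · (1 + m w z)³ = z`, `3 = 0` ⇒
    `((w z)², (w z) w, a z - z) = (w² z)` PRINCIPAL.
  The characteristic enters only through `(1 + x)³ = 1 + x³` in the last two charts (for `p ≥ 5`
  they read `u·(u, y)` and `w z·(w, z)`: the corner cycle of c8 / tri-1 j262452).
-/

-- single-problem summit: the doubled namespace component `ResolutionOfSingularities` is forced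
set_option linter.dupNamespace false

noncomputable section

namespace Summit.ResolutionOfSingularities.ResolutionOfSingularities.Theorems.WildQuotientResolution.JordanThree

/-! ## §1 Generic: the augmentation ideal of a lifted action on a blow-up chart -/

section Generic

universe u

/-- **Augmentation upstairs = augmentation downstairs + the moves of the chart generators.** In the
abstract chart setting of `TerminalBlowup.span_sub_eq_span_of_chart` — a structure map `ψ : R → A`
with `A` generated over `ψ(R)` by elements `u_l` (`hsurj`), `S` a localisation of `A`,
`ι = (A → S) ∘ ψ`, ring endomorphisms `b` of `R` and `a` of `S` with `a ∘ ι = ι ∘ b` — but with NO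
invariance assumption on the centre: `⟨a y - y : y ∈ S⟩ = ⟨b r - r : r ∈ R⟩·S ⊔ ⟨a ū_l - ū_l : l⟩`.
(`⊆`: the ring maps `S → S/K`, `y ↦ [a y]` and `y ↦ [y]`, agree on `ψ(R)` and on the `u_l`, hence on
`A` and on the localisation `S`; `⊇`: `ι (b r - r) = a (ι r) - ι r`.) The moves `a ū_l` are computed
by `TerminalBlowup.stalkAction_chartGen_of_chart` and its unit-twisted variant. [folklore] -/
theorem span_sub_eq_map_sup_span_of_chart {R A S : Type u} [CommRing R] [CommRing A] [CommRing S]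
    {ι' : Type u} (ψ : R →+* A) (u : ι' → A)
    (hsurj : Function.Surjective (MvPolynomial.eval₂Hom ψ u))
    [Algebra A S] (M : Submonoid A) [IsLocalization M S]
    (ι : R →+* S) (hι : ∀ r, algebraMap A S (ψ r) = ι r)
    (b : R →+* R) (a : S →+* S) (hab : ∀ r, a (ι r) = ι (b r)) :
    Ideal.span (Set.range fun y : S => a y - y) =
      (Ideal.span (Set.range fun r : R => b r - r)).map ι ⊔
        Ideal.span (Set.range fun l : ι' => a (algebraMap A S (u l)) - algebraMap A S (u l)) := by
  classical
  set K := (Ideal.span (Set.range fun r : R => b r - r)).map ι ⊔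
    Ideal.span (Set.range fun l : ι' => a (algebraMap A S (u l)) - algebraMap A S (u l)) with hK
  apply le_antisymm
  · -- `⊆`: the ring maps `S → S/K`, `y ↦ [a y]` and `y ↦ [y]`, agree
    let mk : S →+* S ⧸ K := Ideal.Quotient.mk K
    have hagree : mk.comp a = mk := by
      apply IsLocalization.ringHom_ext M (S := S)
      have key : ((mk.comp a).comp (algebraMap A S)).comp (MvPolynomial.eval₂Hom ψ u) =
          (mk.comp (algebraMap A S)).comp (MvPolynomial.eval₂Hom ψ u) := by
        refine MvPolynomial.ringHom_ext (fun r => ?_) (fun l => ?_)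
        · -- constants: `a (ι r) - ι r = ι (b r - r) ∈ K`
          simp only [RingHom.comp_apply, MvPolynomial.eval₂Hom_C]
          rw [hι, hab, Ideal.Quotient.eq]
          refine Ideal.mem_sup_left ?_
          have e : ι (b r) - ι r = ι (b r - r) := by rw [map_sub]
          rw [e]
          exact Ideal.mem_map_of_mem ι (Ideal.subset_span ⟨r, rfl⟩)
        · -- generators: `a ū_l - ū_l ∈ K` by definition
          simp only [RingHom.comp_apply, MvPolynomial.eval₂Hom_X']
          rw [Ideal.Quotient.eq]
          exact Ideal.mem_sup_right (Ideal.subset_span ⟨l, rfl⟩)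
      exact RingHom.ext fun z => by
        obtain ⟨P, rfl⟩ := hsurj z
        exact RingHom.congr_fun key P
    refine Ideal.span_le.mpr ?_
    rintro _ ⟨y, rfl⟩
    have hy : mk (a y) = mk y := by rw [← RingHom.comp_apply, hagree]
    exact Ideal.Quotient.eq.mp hy
  · -- `⊇`
    rw [hK]
    refine sup_le ?_ ?_
    · rw [Ideal.map_span]
      refine Ideal.span_mono ?_
      rintro _ ⟨_, ⟨r, rfl⟩, rfl⟩
      refine ⟨ι r, ?_⟩
      change a (ι r) - ι r = ι (b r - r)
      rw [map_sub, hab]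
    · refine Ideal.span_mono ?_
      rintro _ ⟨l, rfl⟩
      exact ⟨algebraMap A S (u l), rfl⟩

/-- **`⟨gʲ y - y⟩ ≤ ⟨g y - y⟩`**: the augmentation ideal of a power of a ring endomorphism is
contained in that of the endomorphism (`aʲ⁺¹ y - y = (aʲ (a y) - a y) + (a y - y)`). [folklore] -/
theorem span_pow_sub_le {S : Type u} [CommRing S] (a : S →+* S) (j : ℕ) :
    Ideal.span (Set.range fun y : S => (a ^ j) y - y) ≤
      Ideal.span (Set.range fun y : S => a y - y) := by
  have key : ∀ y : S, (a ^ j) y - y ∈ Ideal.span (Set.range fun y : S => a y - y) := by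
    induction j with
    | zero => intro y; simp
    | succ j ih =>
      intro y
      have e : (a ^ (j + 1)) y - y = ((a ^ j) (a y) - a y) + (a y - y) := by
        rw [pow_succ, RingHom.coe_mul, Function.comp_apply]; ring
      rw [e]
      exact Ideal.add_mem _ (ih (a y)) (Ideal.subset_span ⟨y, rfl⟩)
  refine Ideal.span_le.mpr ?_
  rintro _ ⟨y, rfl⟩
  exact key y

/-- **`⟨gʲ y - y⟩ = ⟨g y - y⟩` when `g` is a power of `gʲ`** (e.g. `g` of prime order `p` and
`p ∤ j`): the augmentation ideals of all generators of a cyclic group of prime order coincide, so the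
divisorial hypothesis for one generator gives it for all. [folklore] -/
theorem span_pow_sub_eq {S : Type u} [CommRing S] (a : S →+* S) (j j' : ℕ)
    (h : (a ^ j) ^ j' = a) :
    Ideal.span (Set.range fun y : S => (a ^ j) y - y) =
      Ideal.span (Set.range fun y : S => a y - y) := by
  apply le_antisymm (span_pow_sub_le a j)
  have h2 := span_pow_sub_le (a ^ j) j'
  rwa [h] at h2

end Generic

/-! ## §2 The five charts of the `J₃` tower as ideal identities -/

section Charts

universe u

variable {S : Type u} [CommRing S]

/-- **Step 1, chart A (`x_b = x_a t`): no terminality issue — the augmentation ideal is everything.**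
From `g x_a = x_a`, `g x_b = x_b + m x_a = x_a (t + m)` the lifted action has `a t = t + m`
(`TerminalBlowup.stalkAction_chartGen_of_chart`), so `a t - t = m` is a unit and any ideal containing
it is `⊤` (at a fixed point the stalk augmentation ideal is then trivially principal). [folklore] -/
theorem step1_chartA_eq_top (t ta m : S) (hm : IsUnit m) (hat : ta = t + m) (I : Ideal S)
    (h : ta - t ∈ I) : I = ⊤ := by
  rw [hat, add_sub_cancel_left] at h
  exact Ideal.eq_top_of_isUnit_mem I h hm

/-- In a LOCAL ring the unit hypothesis of step 1, chart B is automatic: if `a u · (1 + m u) = u` then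
`1 + m u` is a unit (were it in `𝔪`, so would be `u`, hence `m u`, hence `1`). [folklore] -/
theorem isUnit_one_add_mul_of_mul_eq [IsLocalRing S] (u au m : S) (hau : au * (1 + m * u) = u) :
    IsUnit (1 + m * u) := by
  by_contra h
  have hmem : 1 + m * u ∈ IsLocalRing.maximalIdeal S := (IsLocalRing.mem_maximalIdeal _).mpr h
  have hu : u ∈ IsLocalRing.maximalIdeal S := by
    rw [← hau]; exact Ideal.mul_mem_left _ _ hmem
  have h1 : (1 : S) ∈ IsLocalRing.maximalIdeal S := by
    have e : (1 : S) = (1 + m * u) - m * u := by ring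
    rw [e]
    exact Ideal.sub_mem _ hmem (Ideal.mul_mem_left _ _ hu)
  exact (IsLocalRing.maximalIdeal.isMaximal S).ne_top (Ideal.eq_top_of_isUnit_mem _ h1 isUnit_one)

/-- **Step 1, chart B (`x_a = x_b u`; chart generator `x_b`, twisted by `e = 1 + m u`).** The lifted
action satisfies `a u · (1 + m u) = u` (`g x_a = x_a = x_b · u`, `g x_b = x_b (1 + m u)`, twisted
chart-generator lemma (5′)); with `m` and `1 + m u` units, the augmentation ideal
`(x_a, x_b)·S + (a u - u) = (x_b u, x_b, a u - u)` equals `(x_b, u²)` — NOT principal along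
`C₁ = V(x_b, u)`, the centre of step 2. (`a u - u = -m e' u²` with `e' (1 + m u) = 1`.) [folklore] -/
theorem step1_chartB_span_eq (xb u au m : S) (hm : IsUnit m) (he : IsUnit (1 + m * u))
    (hau : au * (1 + m * u) = u) :
    Ideal.span ({xb * u, xb, au - u} : Set S) = Ideal.span ({xb, u ^ 2} : Set S) := by
  obtain ⟨m', hmm'⟩ := hm.exists_right_inv
  obtain ⟨e', hee'⟩ := he.exists_right_inv
  apply le_antisymm
  · refine Ideal.span_le.mpr ?_
    intro x hx
    simp only [Set.mem_insert_iff, Set.mem_singleton_iff] at hx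
    rcases hx with rfl | rfl | rfl
    · exact Ideal.mul_mem_right _ _ (Ideal.subset_span (Set.mem_insert _ _))
    · exact Ideal.subset_span (Set.mem_insert _ _)
    · refine Ideal.mem_span_pair.mpr ⟨0, -(m * e'), ?_⟩
      linear_combination (au - u) * hee' - e' * hau
  · rw [Ideal.span_insert, sup_le_iff, Ideal.span_singleton_le_iff_mem,
      Ideal.span_singleton_le_iff_mem]
    refine ⟨Ideal.subset_span (Set.mem_insert_of_mem _ (Set.mem_insert _ _)), ?_⟩
    have hmem : (-(m' * (1 + m * u))) * (au - u) ∈ Ideal.span ({xb * u, xb, au - u} : Set S) :=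
      Ideal.mul_mem_left _ _
        (Ideal.subset_span (Set.mem_insert_of_mem _ (Set.mem_insert_of_mem _ (Set.mem_singleton _))))
    have e : (-(m' * (1 + m * u))) * (au - u) = u ^ 2 := by
      linear_combination (-m') * hau + u ^ 2 * hmm'
    rwa [e] at hmem

/-- **Step 2, chart B1 (`u = x_b v`; chart generator `x_b`, twisted by `e = 1 + m x_b v`): TERMINAL.**
The lifted action satisfies `a v · (1 + m x_b v)² = v` (`g u = u (1 + m u)⁻¹ = x_b · v (1 + m u)⁻¹`),
and the augmentation ideal `(x_b, u²)·S + (a v - v) = (x_b, (x_b v)², a v - v)` is the PRINCIPAL ideal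
`(x_b)` of the exceptional divisor (`a v - v = -a v · x_b · (2 m v + m² x_b v²)`). [folklore] -/
theorem step2_chartB1_span_eq (xb v av m : S) (hav : av * (1 + m * (xb * v)) ^ 2 = v) :
    Ideal.span ({xb, (xb * v) ^ 2, av - v} : Set S) = Ideal.span ({xb} : Set S) := by
  apply le_antisymm
  · refine Ideal.span_le.mpr ?_
    intro x hx
    simp only [Set.mem_insert_iff, Set.mem_singleton_iff] at hx
    rcases hx with rfl | rfl | rfl
    · exact Ideal.subset_span (Set.mem_singleton _)
    · exact Ideal.mem_span_singleton'.mpr ⟨xb * v ^ 2, by ring⟩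
    · refine Ideal.mem_span_singleton'.mpr ⟨-(av * (2 * m * v + m ^ 2 * xb * v ^ 2)), ?_⟩
      linear_combination (-1 : S) * hav
  · rw [Ideal.span_singleton_le_iff_mem]
    exact Ideal.subset_span (Set.mem_insert _ _)

/-- **Step 2, chart B2 (`x_b = u w`; chart generator `u`, twisted by `e = (1 + m u)⁻¹`).** The lifted
action satisfies `a w = w (1 + m u)²` (`g x_b = x_b (1 + m u) = u · w (1 + m u)`), and the
augmentation ideal `(x_b, u²)·S + (a w - w) = (u w, u², a w - w)` equals `u·(u, w) = (u², u w)` —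
NOT principal along `C₂ = V(u, w) = E₂ ∩ E₁′`, the centre of step 3
(`a w - w = u w · (2 m + m² u)`; no hypothesis on `m`). [folklore] -/
theorem step2_chartB2_span_eq (u w aw m : S) (haw : aw = w * (1 + m * u) ^ 2) :
    Ideal.span ({u * w, u ^ 2, aw - w} : Set S) = Ideal.span ({u ^ 2, u * w} : Set S) := by
  apply le_antisymm
  · refine Ideal.span_le.mpr ?_
    intro x hx
    simp only [Set.mem_insert_iff, Set.mem_singleton_iff] at hx
    rcases hx with rfl | rfl | rfl
    · exact Ideal.subset_span (Set.mem_insert_of_mem _ (Set.mem_singleton _))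
    · exact Ideal.subset_span (Set.mem_insert _ _)
    · refine Ideal.mem_span_pair.mpr ⟨0, 2 * m + m ^ 2 * u, ?_⟩
      linear_combination (-1 : S) * haw
  · refine Ideal.span_le.mpr ?_
    intro x hx
    simp only [Set.mem_insert_iff, Set.mem_singleton_iff] at hx
    rcases hx with rfl | rfl
    · exact Ideal.subset_span (Set.mem_insert_of_mem _ (Set.mem_insert _ _))
    · exact Ideal.subset_span (Set.mem_insert _ _)

/-- Step 2, chart B2, OFF the strict transform `E₁′ = V(w)`: where `w` is a unit the augmentation
ideal `(u², u w)` is the PRINCIPAL ideal `(u)` of `E₂` — terminal. [folklore] -/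
theorem step2_chartB2_span_eq_of_isUnit (u w : S) (hw : IsUnit w) :
    Ideal.span ({u ^ 2, u * w} : Set S) = Ideal.span ({u} : Set S) := by
  obtain ⟨w', hww'⟩ := hw.exists_right_inv
  apply le_antisymm
  · refine Ideal.span_le.mpr ?_
    intro x hx
    simp only [Set.mem_insert_iff, Set.mem_singleton_iff] at hx
    rcases hx with rfl | rfl
    · exact Ideal.mem_span_singleton'.mpr ⟨u, by ring⟩
    · exact Ideal.mem_span_singleton'.mpr ⟨w, by ring⟩
  · rw [Ideal.span_singleton_le_iff_mem]
    have hmem : w' * (u * w) ∈ Ideal.span ({u ^ 2, u * w} : Set S) :=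
      Ideal.mul_mem_left _ _ (Ideal.subset_span (Set.mem_insert_of_mem _ (Set.mem_singleton _)))
    have e : w' * (u * w) = u := by linear_combination u * hww'
    rwa [e] at hmem

/-- Step 2, chart B2, OFF the exceptional divisor `E₂ = V(u)`: where `u` is a unit the augmentation
ideal `(u², u w)` is `⊤` (no fixed point with a proper augmentation ideal there). [folklore] -/
theorem step2_chartB2_span_eq_top_of_isUnit (u w : S) (hu : IsUnit u) :
    Ideal.span ({u ^ 2, u * w} : Set S) = ⊤ :=
  Ideal.eq_top_of_isUnit_mem _ (Ideal.subset_span (Set.mem_insert _ _)) (hu.pow 2)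

/-- **Step 3, chart B2a (`w = u y`; chart generator `u`, twisted by `e = (1 + m u)⁻¹`): TERMINAL in
characteristic 3.** The lifted action satisfies `a y = y (1 + m u)³` (`g w = w (1 + m u)² =
u · y (1 + m u)²`); since `(1 + m u)³ = 1 + m³ u³` when `3 = 0`, the augmentation ideal
`(u², u w)·S + (a y - y) = (u², u·(u y), a y - y)` is the PRINCIPAL ideal `(u²)` — the fixed divisor
`2 E₂`. (For `p ≥ 5` it would be `u·(u, y)`: the corner cycle.) [folklore] -/
theorem step3_chartB2a_span_eq (u y ay m : S) (h3 : (3 : S) = 0) (hay : ay = y * (1 + m * u) ^ 3) :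
    Ideal.span ({u ^ 2, u * (u * y), ay - y} : Set S) = Ideal.span ({u ^ 2} : Set S) := by
  apply le_antisymm
  · refine Ideal.span_le.mpr ?_
    intro x hx
    simp only [Set.mem_insert_iff, Set.mem_singleton_iff] at hx
    rcases hx with rfl | rfl | rfl
    · exact Ideal.subset_span (Set.mem_singleton _)
    · exact Ideal.mem_span_singleton'.mpr ⟨y, by ring⟩
    · refine Ideal.mem_span_singleton'.mpr ⟨m ^ 3 * u * y, ?_⟩
      linear_combination (-1 : S) * hay + (-(y * (m * u + m ^ 2 * u ^ 2))) * h3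
  · rw [Ideal.span_singleton_le_iff_mem]
    exact Ideal.subset_span (Set.mem_insert _ _)

/-- **Step 3, chart B2b (`u = w z`; chart generator `w`, twisted by `e = (1 + m w z)²`): TERMINAL in
characteristic 3.** The lifted action satisfies `a z · (1 + m w z)³ = z` (`g u = u (1 + m u)⁻¹ =
w · z (1 + m w z)⁻¹`); since `(1 + m w z)³ = 1 + m³ w³ z³` when `3 = 0`, the augmentation ideal
`(u², u w)·S + (a z - z) = ((w z)², (w z) w, a z - z)` is the PRINCIPAL ideal `(w² z)` — the fixed
divisor `2 E₁′ + E₃`. (For `p ≥ 5` it would be `w z·(w, z)`: the corner cycle.) [folklore] -/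
theorem step3_chartB2b_span_eq (w z az m : S) (h3 : (3 : S) = 0)
    (haz : az * (1 + m * (w * z)) ^ 3 = z) :
    Ideal.span ({(w * z) ^ 2, (w * z) * w, az - z} : Set S) = Ideal.span ({w ^ 2 * z} : Set S) := by
  apply le_antisymm
  · refine Ideal.span_le.mpr ?_
    intro x hx
    simp only [Set.mem_insert_iff, Set.mem_singleton_iff] at hx
    rcases hx with rfl | rfl | rfl
    · exact Ideal.mem_span_singleton'.mpr ⟨z, by ring⟩
    · exact Ideal.mem_span_singleton'.mpr ⟨1, by ring⟩
    · refine Ideal.mem_span_singleton'.mpr ⟨-(az * m ^ 3 * w * z ^ 2), ?_⟩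
      linear_combination (-1 : S) * haz + (az * (m * (w * z) + m ^ 2 * (w * z) ^ 2)) * h3
  · rw [Ideal.span_singleton_le_iff_mem]
    have hmem : (w * z) * w ∈ Ideal.span ({(w * z) ^ 2, (w * z) * w, az - z} : Set S) :=
      Ideal.subset_span (Set.mem_insert_of_mem _ (Set.mem_insert _ _))
    have e : (w * z) * w = w ^ 2 * z := by ring
    exact (congrArg (· ∈ Ideal.span ({(w * z) ^ 2, (w * z) * w, az - z} : Set S)) e).mp hmem

end Charts

end Summit.ResolutionOfSingularities.ResolutionOfSingularities.Theorems.WildQuotientResolution.JordanThree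

end
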